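import Mathlib
import Summits.ValiantsHypothesis.ValiantsHypothesis.Theorems.GrenetZeonHessianRankCodimTwoLatinTableBridge
import Summits.ValiantsHypothesis.ValiantsHypothesis.Theorems.GrenetZeonHessianRankCodimTwoBorderTable
import HarnessLib

/-!
# Crux `GrenetZeon.HessianRankCodimTwo` (stmt-ValiantsHypothesis-8061), line `good_plane`, ALL large `n`:
# table identity for the core block values of the bordered Latin point

Seat val-width-8061-p1 g2 (memo `Cruxes/HessianRankCodimTwo/BorderedLatinAllN.md`).  For the bordered Latin
plane of `Theorems/…BorderDefs.lean`:

* `bordBlockValue_eq_mul_bordPsi` — **`h_{IJ}(bordPoint p r a) = (p-2)!·p!·p!·r! · Ψ_{IJ}(a)`** with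
  `Ψ_{IJ} = bordPsi ℤ p r I J = [y^{(p,p,p;r) - 2e_J}] ℓ_I^{p-2} ℓ_{I+1}^p ℓ_{I+2}^p ℓ_{none}^r`, hence
  `bordBlockValue_eq_zero_iff_bordPsi` — a core block value vanishes iff `Ψ_{IJ}(a) = 0`.

Proof as in Theorem P, part B (p4's `…LatinBlockTable`): the Hessian entry is a sum over permutations pinned
at the two removed positions (`hess0_transl_perPoly`); pinned permutations correspond to permutations of the
remaining rows (`sum_filter_pinned_eq_sum_perm_subtype_bord`); then the engine `sum_perm_comp_eq_smul_sum` and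
the generating-function coefficient `coeff_prod_bordRowForm_card`.  VP ≠ VNP is not moved by anything here.
-/

noncomputable section

open MvPolynomial Finset Equiv
open Literature.Computability.AlgebraicComplexity

-- single-conjunct layout `Summits/ValiantsHypothesis/ValiantsHypothesis`: duplicated namespace by design
set_option linter.dupNamespace false

namespace Summit.ValiantsHypothesis.ValiantsHypothesis.Theorems.GrenetZeonHessianRankCodimTwo

variable {p r : ℕ}

/-! ### The removed rows and columns -/

/-- The chosen indices lie in their core block. [folklore] -/
theorem bordBlk_bordIdx (hp : 2 ≤ p) (I : Fin 3) (s : Fin 2) : bordBlk p r (bordIdx p r hp I s) = some I := by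
  have hs := s.isLt
  have hlt : (bordIdx p r hp I s).val < 3 * p := by
    show I.val * p + s.val < 3 * p
    have := I.isLt; nlinarith
  rw [bordBlk_of_lt (by omega) hlt, Option.some.injEq]
  apply Fin.ext
  show (I.val * p + s.val) / p = I.val
  rw [show I.val * p + s.val = s.val + p * I.val by ring, Nat.add_mul_div_left _ _ (by omega),
    Nat.div_eq_of_lt (by omega), zero_add]

/-- The two chosen indices of (possibly different) blocks are distinct. [folklore] -/
theorem bordIdx_zero_ne_bordIdx_one (hp : 2 ≤ p) (I J : Fin 3) :
    bordIdx p r hp I 0 ≠ bordIdx p r hp J 1 := by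
  intro h
  have h' := congrArg Fin.val h
  simp only [bordIdx, Fin.val_zero, Fin.val_one, add_zero] at h'
  fin_cases I <;> fin_cases J <;> simp at h' <;> omega

/-! ### The block value as a pinned sum -/

/-- Step 1: the core block value `(I, J)` as the evaluation of a sum over the permutations `τ`
(rows → columns) pinned at the two removed positions. [folklore] -/
theorem bordBlockValue_eq_aeval_sum_filter (hp : 2 ≤ p) (a : Fin 3 → ℂ) (I J : Fin 3) :
    bordBlockValue p r hp a I J =
      aeval a (∑ τ ∈ univ.filter (fun τ : Perm (Fin (3 * p + r)) =>
          τ (bordIdx p r hp I 0) = bordIdx p r hp J 0 ∧ τ (bordIdx p r hp I 1) = bordIdx p r hp J 1),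
        ∏ ρ ∈ univ.filter (fun ρ : Fin (3 * p + r) => ρ ≠ bordIdx p r hp I 0 ∧ ρ ≠ bordIdx p r hp I 1),
          bordEnt ℤ (bordBlk p r ρ) (bordBlk p r (τ ρ))) := by
  have hj : bordIdx p r hp J 0 ≠ bordIdx p r hp J 1 := bordIdx_zero_ne_bordIdx_one hp J J
  rw [bordBlockValue, hess0_transl_perPoly, map_sum]
  rw [← Equiv.sum_comp (Equiv.inv (Perm (Fin (3 * p + r))))]
  simp only [Equiv.inv_apply]
  rw [← Finset.sum_filter]
  refine Finset.sum_congr ?_ fun τ hτ => ?_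
  · ext τ
    simp only [Finset.mem_filter, Finset.mem_univ, true_and, Perm.inv_eq_iff_eq]
    constructor
    · rintro ⟨h1, -, h0⟩
      exact ⟨h0.symm, h1.symm⟩
    · rintro ⟨h0, h1⟩
      exact ⟨h1.symm, hj, h0.symm⟩
  · obtain ⟨h0, h1⟩ := (Finset.mem_filter.mp hτ).2
    rw [map_prod]
    symm
    refine Finset.prod_equiv τ (fun ρ => ?_) (fun ρ _ => ?_)
    · simp only [Finset.mem_filter, Finset.mem_univ, true_and, Finset.mem_erase, ne_eq, ← h0, ← h1,
        EmbeddingLike.apply_eq_iff_eq]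
      tauto
    · rw [bordPoint_apply_eq_aeval]
      simp only [Perm.coe_inv, Equiv.symm_apply_apply]

/-- Step 2: the pinned permutations `τ` correspond (via `τ ↦ θ⁻¹ τ` for any fixed `θ` moving the removed rows
onto the removed columns) to the permutations of the remaining rows. [folklore] -/
theorem sum_filter_pinned_eq_sum_perm_subtype_bord (hp : 2 ≤ p) (I J : Fin 3)
    (θ : Perm (Fin (3 * p + r)))
    (hθ₀ : θ (bordIdx p r hp I 0) = bordIdx p r hp J 0)
    (hθ₁ : θ (bordIdx p r hp I 1) = bordIdx p r hp J 1) :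
    ∑ τ ∈ univ.filter (fun τ : Perm (Fin (3 * p + r)) =>
          τ (bordIdx p r hp I 0) = bordIdx p r hp J 0 ∧ τ (bordIdx p r hp I 1) = bordIdx p r hp J 1),
        ∏ ρ ∈ univ.filter (fun ρ : Fin (3 * p + r) => ρ ≠ bordIdx p r hp I 0 ∧ ρ ≠ bordIdx p r hp I 1),
          bordEnt ℤ (bordBlk p r ρ) (bordBlk p r (τ ρ)) =
      ∑ ψ : Perm {ρ : Fin (3 * p + r) // ρ ≠ bordIdx p r hp I 0 ∧ ρ ≠ bordIdx p r hp I 1},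
        ∏ ρ, bordEnt ℤ (bordBlk p r ρ.1) (bordBlk p r (θ (ψ ρ).1)) := by
  set i₀ := bordIdx p r hp I 0 with hi₀
  set i₁ := bordIdx p r hp I 1 with hi₁
  set j₀ := bordIdx p r hp J 0 with hj₀
  set j₁ := bordIdx p r hp J 1 with hj₁
  have pres : ∀ τ ∈ univ.filter (fun τ : Perm (Fin (3 * p + r)) => τ i₀ = j₀ ∧ τ i₁ = j₁),
      ∀ x, (fun ρ : Fin (3 * p + r) => ρ ≠ i₀ ∧ ρ ≠ i₁) ((θ⁻¹ * τ) x) ↔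
        (fun ρ : Fin (3 * p + r) => ρ ≠ i₀ ∧ ρ ≠ i₁) x := by
    intro τ hτ x
    obtain ⟨h0, h1⟩ := (Finset.mem_filter.mp hτ).2
    have e0 : (θ⁻¹ * τ) x = i₀ ↔ x = i₀ := by
      rw [Perm.mul_apply, Perm.inv_eq_iff_eq, hθ₀, ← h0, EmbeddingLike.apply_eq_iff_eq]
    have e1 : (θ⁻¹ * τ) x = i₁ ↔ x = i₁ := by
      rw [Perm.mul_apply, Perm.inv_eq_iff_eq, hθ₁, ← h1, EmbeddingLike.apply_eq_iff_eq]
    simp only [ne_eq, e0, e1]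
  have fix : ∀ τ ∈ univ.filter (fun τ : Perm (Fin (3 * p + r)) => τ i₀ = j₀ ∧ τ i₁ = j₁),
      ∀ x, (θ⁻¹ * τ) x ≠ x → (fun ρ : Fin (3 * p + r) => ρ ≠ i₀ ∧ ρ ≠ i₁) x := by
    intro τ hτ x hx
    obtain ⟨h0, h1⟩ := (Finset.mem_filter.mp hτ).2
    refine ⟨fun hx0 => hx ?_, fun hx1 => hx ?_⟩
    · rw [hx0, Perm.mul_apply, h0, ← hθ₀]
      simp
    · rw [hx1, Perm.mul_apply, h1, ← hθ₁]
      simp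
  have hni₀ : ¬ (i₀ ≠ i₀ ∧ i₀ ≠ i₁) := fun h => h.1 rfl
  have hni₁ : ¬ (i₁ ≠ i₀ ∧ i₁ ≠ i₁) := fun h => h.2 rfl
  refine Finset.sum_bij' (fun τ hτ => (θ⁻¹ * τ).subtypePerm (pres τ hτ))
    (fun ψ _ => θ * Perm.ofSubtype ψ) (fun _ _ => Finset.mem_univ _) (fun ψ _ => ?_)
    (fun τ hτ => ?_) (fun ψ _ => ?_) (fun τ hτ => ?_)
  · refine Finset.mem_filter.mpr ⟨Finset.mem_univ _, ?_, ?_⟩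
    · rw [Perm.mul_apply, Perm.ofSubtype_apply_of_not_mem ψ hni₀, hθ₀]
    · rw [Perm.mul_apply, Perm.ofSubtype_apply_of_not_mem ψ hni₁, hθ₁]
  · rw [Perm.ofSubtype_subtypePerm (pres τ hτ) (fix τ hτ), mul_inv_cancel_left]
  · refine Equiv.ext fun x => Subtype.ext ?_
    simp only [Perm.subtypePerm_apply, Perm.mul_apply, Perm.ofSubtype_apply_coe, Perm.coe_inv,
      Equiv.symm_apply_apply]
  · rw [Finset.prod_subtype (p := fun ρ : Fin (3 * p + r) => ρ ≠ i₀ ∧ ρ ≠ i₁)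
      (univ.filter fun ρ : Fin (3 * p + r) => ρ ≠ i₀ ∧ ρ ≠ i₁) (fun x => by simp)]
    refine Fintype.prod_congr _ _ fun ρ => ?_
    simp only [Perm.subtypePerm_apply, Perm.mul_apply, Perm.coe_inv, Equiv.apply_symm_apply]

/-- Step 3: the labelling `ρ ↦ blk (θ ρ)` of the remaining rows has the fibre sizes `(p,p,p;r) - 2e_J`.
[folklore] -/
theorem card_subtype_bordBlk_perm_eq (hp : 2 ≤ p) (I J : Fin 3) (θ : Perm (Fin (3 * p + r)))
    (hθ₀ : θ (bordIdx p r hp I 0) = bordIdx p r hp J 0)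
    (hθ₁ : θ (bordIdx p r hp I 1) = bordIdx p r hp J 1) (K : Option (Fin 3)) :
    Fintype.card {ρ : {ρ : Fin (3 * p + r) // ρ ≠ bordIdx p r hp I 0 ∧ ρ ≠ bordIdx p r hp I 1} //
        bordBlk p r (θ ρ.1) = K} = bordNuBlock p r J K := by
  set i₀ := bordIdx p r hp I 0 with hi₀
  set i₁ := bordIdx p r hp I 1 with hi₁
  set j₀ := bordIdx p r hp J 0 with hj₀
  set j₁ := bordIdx p r hp J 1 with hj₁
  have hj : j₀ ≠ j₁ := bordIdx_zero_ne_bordIdx_one hp J J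
  have hrj₀ : bordBlk p r j₀ = some J := bordBlk_bordIdx hp J 0
  have hrj₁ : bordBlk p r j₁ = some J := bordBlk_bordIdx hp J 1
  have e : {ρ : {ρ : Fin (3 * p + r) // ρ ≠ i₀ ∧ ρ ≠ i₁} // bordBlk p r (θ ρ.1) = K} ≃
      {c : Fin (3 * p + r) // (c ≠ j₀ ∧ c ≠ j₁) ∧ bordBlk p r c = K} :=
    (Equiv.subtypeSubtypeEquivSubtypeInter (fun ρ : Fin (3 * p + r) => ρ ≠ i₀ ∧ ρ ≠ i₁)
      (fun ρ => bordBlk p r (θ ρ) = K)).trans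
      (Equiv.subtypeEquiv θ fun ρ => by
        rw [← hθ₀, ← hθ₁]
        simp only [ne_eq, EmbeddingLike.apply_eq_iff_eq])
  rw [Fintype.card_congr e, Fintype.card_subtype]
  have hF : (univ.filter fun c : Fin (3 * p + r) => (c ≠ j₀ ∧ c ≠ j₁) ∧ bordBlk p r c = K) =
      ((univ.filter fun c : Fin (3 * p + r) => bordBlk p r c = K).erase j₀).erase j₁ := by
    ext c
    simp only [Finset.mem_filter, Finset.mem_univ, true_and, Finset.mem_erase, ne_eq]
    tauto
  rw [hF]
  have hp0 : 0 < p := by omega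
  by_cases hK : K = some J
  · subst hK
    rw [bordNuBlock_apply_some, if_pos rfl, Finset.card_erase_of_mem, Finset.card_erase_of_mem,
      card_filter_bordBlk_some hp0]
    · omega
    · exact Finset.mem_filter.mpr ⟨Finset.mem_univ _, hrj₀⟩
    · exact Finset.mem_erase.mpr ⟨hj.symm, Finset.mem_filter.mpr ⟨Finset.mem_univ _, hrj₁⟩⟩
  · rw [Finset.erase_eq_of_notMem, Finset.erase_eq_of_notMem, card_filter_bordBlk_eq hp0]
    · rcases K with _ | K
      · rw [bordNuPer_apply_none, bordNuBlock_apply_none]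
      · rw [bordNuPer_apply_some, bordNuBlock_apply_some, if_neg (fun h => hK (by rw [h]))]
    · simp only [Finset.mem_filter, Finset.mem_univ, true_and, hrj₀]
      exact fun h => hK h.symm
    · simp only [Finset.mem_erase, Finset.mem_filter, Finset.mem_univ, true_and, hrj₁, ne_eq]
      exact fun h => hK h.2.symm

/-- Fibre sizes of the remaining rows themselves (`θ = 1`, `J = I`). [folklore] -/
theorem card_filter_subtype_bordBlk_eq (hp : 2 ≤ p) (I : Fin 3) (K : Option (Fin 3)) :
    #(univ.filter fun ρ : {ρ : Fin (3 * p + r) // ρ ≠ bordIdx p r hp I 0 ∧ ρ ≠ bordIdx p r hp I 1} =>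
        bordBlk p r ρ.1 = K) = bordNuBlock p r I K := by
  rw [← Fintype.card_subtype]
  exact card_subtype_bordBlk_perm_eq hp I I 1 rfl rfl K

/-- `Π_{ρ ≠ i₀, i₁} f(blk ρ) = f(I)^{p-2} (f(I+1)^p f(I+2)^p) f(none)^r`. [folklore] -/
theorem prod_subtype_comp_bordBlk_eq {M : Type*} [CommMonoid M] (hp : 2 ≤ p) (I : Fin 3)
    (f : Option (Fin 3) → M) :
    ∏ ρ : {ρ : Fin (3 * p + r) // ρ ≠ bordIdx p r hp I 0 ∧ ρ ≠ bordIdx p r hp I 1}, f (bordBlk p r ρ.1) =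
      f (some I) ^ (p - 2) * (f (some (I + 1)) ^ p * f (some (I + 2)) ^ p) * f none ^ r := by
  rw [← Finset.prod_fiberwise' univ
    (fun ρ : {ρ : Fin (3 * p + r) // ρ ≠ bordIdx p r hp I 0 ∧ ρ ≠ bordIdx p r hp I 1} =>
      bordBlk p r ρ.1) f, Fintype.prod_option, mul_comm, Finset.prod_const, card_filter_subtype_bordBlk_eq hp,
    bordNuBlock_apply_none]
  congr 1
  rw [← prod_pow_ite_fin_three I (fun K => f (some K)) (p - 2) p]
  refine Fintype.prod_congr _ _ fun K => ?_
  rw [Finset.prod_const, card_filter_subtype_bordBlk_eq hp, bordNuBlock_apply_some]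

/-- **Table identity for the core block values:** the pinned sum equals `((p-2)!·p!·p!·r!) • Ψ_{IJ}`.
[folklore] -/
theorem sum_filter_pinned_eq_smul_bordPsi (hp : 2 ≤ p) (I J : Fin 3) :
    (∑ τ ∈ univ.filter (fun τ : Perm (Fin (3 * p + r)) =>
          τ (bordIdx p r hp I 0) = bordIdx p r hp J 0 ∧ τ (bordIdx p r hp I 1) = bordIdx p r hp J 1),
        ∏ ρ ∈ univ.filter (fun ρ : Fin (3 * p + r) => ρ ≠ bordIdx p r hp I 0 ∧ ρ ≠ bordIdx p r hp I 1),
          bordEnt ℤ (bordBlk p r ρ) (bordBlk p r (τ ρ))) =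
      ((p - 2).factorial * p.factorial * p.factorial * r.factorial) • bordPsi ℤ p r I J := by
  classical
  have hii : bordIdx p r hp I 0 ≠ bordIdx p r hp I 1 := bordIdx_zero_ne_bordIdx_one hp I I
  have hij : bordIdx p r hp I 0 ≠ bordIdx p r hp J 1 := bordIdx_zero_ne_bordIdx_one hp I J
  have hji : bordIdx p r hp J 0 ≠ bordIdx p r hp I 1 := bordIdx_zero_ne_bordIdx_one hp J I
  have hjj : bordIdx p r hp J 0 ≠ bordIdx p r hp J 1 := bordIdx_zero_ne_bordIdx_one hp J J
  obtain ⟨θ, hθ₀, hθ₁⟩ : ∃ θ : Perm (Fin (3 * p + r)),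
      θ (bordIdx p r hp I 0) = bordIdx p r hp J 0 ∧ θ (bordIdx p r hp I 1) = bordIdx p r hp J 1 := by
    refine ⟨Equiv.swap (bordIdx p r hp I 0) (bordIdx p r hp J 0) *
      Equiv.swap (bordIdx p r hp I 1) (bordIdx p r hp J 1), ?_, ?_⟩
    · rw [Perm.mul_apply, Equiv.swap_apply_of_ne_of_ne hii hij, Equiv.swap_apply_left]
    · rw [Perm.mul_apply, Equiv.swap_apply_left, Equiv.swap_apply_of_ne_of_ne hij.symm hjj.symm]
  rw [sum_filter_pinned_eq_sum_perm_subtype_bord hp I J θ hθ₀ hθ₁]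
  rw [show (∑ ψ : Perm {ρ : Fin (3 * p + r) // ρ ≠ bordIdx p r hp I 0 ∧ ρ ≠ bordIdx p r hp I 1},
        ∏ ρ, bordEnt ℤ (bordBlk p r ρ.1) (bordBlk p r (θ (ψ ρ).1))) =
      ∑ ψ : Perm {ρ : Fin (3 * p + r) // ρ ≠ bordIdx p r hp I 0 ∧ ρ ≠ bordIdx p r hp I 1},
        (fun u : {ρ : Fin (3 * p + r) // ρ ≠ bordIdx p r hp I 0 ∧ ρ ≠ bordIdx p r hp I 1} → Option (Fin 3) =>
          ∏ ρ, bordEnt ℤ (bordBlk p r ρ.1) (u ρ))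
          ((fun ρ : {ρ : Fin (3 * p + r) // ρ ≠ bordIdx p r hp I 0 ∧ ρ ≠ bordIdx p r hp I 1} =>
            bordBlk p r (θ ρ.1)) ∘ ψ) from rfl]
  rw [sum_perm_comp_eq_smul_sum
    (fun ρ : {ρ : Fin (3 * p + r) // ρ ≠ bordIdx p r hp I 0 ∧ ρ ≠ bordIdx p r hp I 1} =>
      bordBlk p r (θ ρ.1))
    (fun u : {ρ : Fin (3 * p + r) // ρ ≠ bordIdx p r hp I 0 ∧ ρ ≠ bordIdx p r hp I 1} → Option (Fin 3) =>
      ∏ ρ, bordEnt ℤ (bordBlk p r ρ.1) (u ρ))]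
  have hN : ∏ K : Option (Fin 3), (Fintype.card
      {ρ : {ρ : Fin (3 * p + r) // ρ ≠ bordIdx p r hp I 0 ∧ ρ ≠ bordIdx p r hp I 1} //
        bordBlk p r (θ ρ.1) = K}).factorial =
      (p - 2).factorial * p.factorial * p.factorial * r.factorial := by
    simp_rw [card_subtype_bordBlk_perm_eq hp I J θ hθ₀ hθ₁]
    rw [Fintype.prod_option, bordNuBlock_apply_none]
    simp_rw [bordNuBlock_apply_some]
    rw [← Finset.mul_prod_erase univ _ (Finset.mem_univ J), if_pos rfl,
      Finset.prod_congr rfl fun K hK =>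
        (show (if K = J then p - 2 else p).factorial = p.factorial by
          rw [if_neg (Finset.ne_of_mem_erase hK)]),
      Finset.prod_const, Finset.card_erase_of_mem (Finset.mem_univ J), card_univ, Fintype.card_fin]
    ring
  rw [hN]
  congr 1
  -- generating-function side
  rw [bordPsi, ← prod_subtype_comp_bordBlk_eq hp I (bordRowForm ℤ), coeff_prod_bordRowForm_card]
  refine Finset.sum_congr (Finset.filter_congr fun u _ => ?_) fun _ _ => rfl
  refine forall_congr' fun K => ?_
  rw [card_subtype_bordBlk_perm_eq hp I J θ hθ₀ hθ₁, Fintype.card_subtype]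

/-- **The core block value `h_{IJ}` of the bordered Latin point is `(p-2)!·p!·p!·r! · Ψ_{IJ}(a)`.**
[folklore] -/
theorem bordBlockValue_eq_mul_bordPsi (hp : 2 ≤ p) (a : Fin 3 → ℂ) (I J : Fin 3) :
    bordBlockValue p r hp a I J =
      (((p - 2).factorial * p.factorial * p.factorial * r.factorial : ℕ) : ℂ) *
        aeval a (bordPsi ℤ p r I J) := by
  rw [bordBlockValue_eq_aeval_sum_filter hp, sum_filter_pinned_eq_smul_bordPsi hp, map_nsmul, nsmul_eq_mul]

/-- On the bordered Latin plane a core block value vanishes iff `Ψ_{IJ}(a) = 0`. [folklore] -/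
theorem bordBlockValue_eq_zero_iff_bordPsi (hp : 2 ≤ p) (a : Fin 3 → ℂ) (I J : Fin 3) :
    bordBlockValue p r hp a I J = 0 ↔ aeval a (bordPsi ℤ p r I J) = 0 := by
  rw [bordBlockValue_eq_mul_bordPsi hp, mul_eq_zero, or_iff_right]
  exact_mod_cast mul_ne_zero (mul_ne_zero (mul_ne_zero (Nat.factorial_ne_zero _) (Nat.factorial_ne_zero _))
    (Nat.factorial_ne_zero _)) (Nat.factorial_ne_zero _)

end Summit.ValiantsHypothesis.ValiantsHypothesis.Theorems.GrenetZeonHessianRankCodimTwo
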